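import Summits.BirchSwinnertonDyer.BirchSwinnertonDyer.Theses.UniversalToricDescent
import Summits.BirchSwinnertonDyer.BirchSwinnertonDyer.Theorems.UniversalToricDescentToricTransportModThreeStubRatSqueeze
import Summits.BirchSwinnertonDyer.BirchSwinnertonDyer.Theorems.UniversalToricDescentAcDualMuZeroCriterion
import Summits.BirchSwinnertonDyer.Rank1Residual.WAll.TargetAdditiveAtThreeWildLocalTypeDecompLine
import HarnessLib

/-!
# Line `wild_ps_retyping` — crux `AdditiveSplitIMCInclusionAtThree` (stmt-BirchSwinnertonDyer-20395), gen 21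

NODE (D-0171) for the crux idea **wild-PS re-typing source** (`Ideas/wild-ps-retyping.md`).

The wall splits as WALL ⟸ RATWALL ∧ μ-half (landed criterion; kernel road of g10/g14 verbatim, §5).  The μ-half is
`ResidualSelmerFiniteAtThreeSurj` (§0a, same normalised text as g8/g10/g14).  g14 (`serre_source_transport`) stratified it
by the mod-3 type at 3 into stratum R (good-ORDINARY residual type: Serre-optimal ordinary source, print-adjacent) and
its complement (très ramifié / unramified-sub / niveau 2), recorded there as BARRIER «no print engine, no ordinary source».

THIS node refines the complement by the tree's own «no `D₃`-stable line» predicate (§0b `LocallyIrreducibleModThreeType`,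
niveau 2) and records the NEW SOURCE that serves it: by Breuil–Mézard for potentially Barsotti–Tate types (Gee–Kisin;
Emerton–Gee Thm 8.6.1, `p > 2`, `ρ̄` arbitrary) and the Brauer-character identity
`[𝔽₃[ℙ¹(ℤ/9)]] = 2·[1] + [det] + 2·[Sym²] + [Sym² ⊗ det]` in `K₀(GL₂(𝔽₃))`, EVERY `ρ̄ = E[3]|_{G_{ℚ₃}}` admits a
potentially Barsotti–Tate lift of the WILD PRINCIPAL-SERIES inertial type `τ = η ⊕ 1` (`η` the order-3 character of
conductor 9); Kisin's potentially-BT modularity lifting at `p = 3` (`ρ̄|_{ℚ(ζ₃)}` absolutely irreducible — automatic for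
`im ρ̄ = GL₂(𝔽₃)`) + Khare–Wintenberger/Gee existence give a weight-2 newform `g` on `Γ₁(9·N(ρ̄))`, nebentypus of
conductor 9 and order 3, `g ≡ f_E (mod λ)`, with `U₃ g = a₃(g) g`, `a₃(g) ≠ 0`; on the niveau-2 rows `v₃(a₃(g)) = ½` is
FORCED (Dieudonné–Manin slopes of the height-2 `𝒪_λ`-divisible group of `A_g` over `ℚ₃(ζ₉)⁺`, where `A_g` has GOOD
supersingular reduction).  The `(∅,0)` residual Selmer module over `K_∞` is TYPE-BLIND (no local line at 3 is ever chosen),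
so `μ(X_(∅,0)(E/K_∞)) = 0 ⟺ μ(X_(∅,0)(A_g/K_∞)_λ) = 0` (Greenberg–Vatsal shape, Σ-imprimitive, exact), and the Heegner
tower of `g` over `K_m` is α-COHERENT (`Tr y_{m+1} = a₃(g)·y_m`) instead of trace-zero: the catalogued obstruction
`TraceZeroHeegnerTowerAtAdditiveSplitP` is a property of `f_E`, not of `ρ̄`.

Pieces (tags in the docstrings; evidence in `Lines/wild_ps_retyping.md`):
* §0a `ResidualSelmerFiniteAtThreeSurj` — the μ-half (UNDECIDED; = g8/g10/g14 text).
* §0b `HasGoodOrdinaryModThreeType` (g14, verbatim) and `LocallyIrreducibleModThreeType` (NEW, tree vocabulary of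
  `WAll/TargetAdditiveAtThreeWildLocalTypeDecompLine`); PROVED: niveau 2 ⊂ g14's complement (§2).
* §1 three row pieces: `SerreSourceResidualFiniteAtThree` (g14, stratum R), `NiveauTwoResidualFiniteAtThree` (NEW:
  wild-PS source, slope ½ forced, `A_g` good supersingular over `ℚ(ζ₉)⁺`; UNDECIDED, leaves ATTACKABLE / IDEA-NEEDED),
  `ReducibleNonOrdinaryRowsResidualFiniteAtThree` (très ramifié & unramified-sub rows: wild-PS source exists too, slope in
  `{½, 1}`; UNDECIDED, leaf BARRIER-adjacent).
* §3 the C₃-descent / 3-power-twist transparency of `μ` as pure algebra (PROVED): a module with a nilpotent endomorphism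
  `φ` and finite `M ⧸ φM` is finite — applied to `φ = σ − 1` on `X/3X` for `σ` of order 3 (`(σ−1)³ = σ³−1 = 0` in char 3).
* §4 registered-shape stubs; §5 kernel `AdditiveSplitIMCInclusionAtThree_of` concluding the crux BY NAME.

Sources: [cite: GreenbergVatsal2000, Thm. (1.4), §2 Prop. (2.8)]; Emerton–Gee 2022 Thm 8.6.1–8.6.2 (= Gee–Kisin 2014
Thm A) [corpus:book:emerton2022-moduli-stacks… p.279–281]; Kisin, Durham 2007 volume p.496 (pot-BT modularity lifting,
`p > 2`) [corpus:book:burns2007-l-functions-galois-representations p.496]; [cite: SerreInventiones1972, §1.11 Prop. 11].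
-/

set_option linter.dupNamespace false
set_option autoImplicit false

noncomputable section

open scoped Classical NumberField
open IsDedekindDomain Rat.HeightOneSpectrum
open WeierstrassCurve Literature.NumberTheory.EllipticCurves
  Literature.NumberTheory.EllipticCurves.Rank1Residual
  Literature.NumberTheory.GaloisRepresentations
open Summit.BirchSwinnertonDyer.Rank1Residual
open Summit.BirchSwinnertonDyer.Rank1Residual.O6 (ModPCongruentAt)
open Summit.BirchSwinnertonDyer.BirchSwinnertonDyer.Theses.UniversalToricDescent
  (RationalSplitIMCInclusionAtThree AdditiveSplitIMCInclusionAtThree)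
open Summit.BirchSwinnertonDyer.BirchSwinnertonDyer.Cruxes.ToricTransportModThree.RatwallThinComb
  (dvd_of_dvd_prime_pow_mul prime_C_three not_C_three_dvd_of_norm_coeff_eq_one)
open Summit.BirchSwinnertonDyer.Rank1Residual.X11b

namespace Summit.BirchSwinnertonDyer.BirchSwinnertonDyer.Cruxes.AdditiveSplitIMCInclusionAtThree.WildPSRetyping

/-! ## §0a The μ-half of the wall (verbatim from g8/g10/g14, same normalised signature) -/

/-- μ-piece (UNDECIDED): residual `(∅,0)`-Selmer finiteness `Sel_{𝔭′}(K_∞, E[3^∞])[3]` finite on the O6 / onto /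
`r_an = 1` rows — equivalently `μ(X_(∅,0)) = 0` given torsion. Identical text to g8/g10/g14.
[cite: GreenbergVatsal2000, Thm. (1.4), §2 Prop. (2.8)] -/
def ResidualSelmerFiniteAtThreeSurj : Prop :=
  ∀ (W : WeierstrassCurve ℚ) [W.IsElliptic] [W.IsGloballyMinimal] (N : ℕ) [NeZero N]
    (K : Type) [Field K] [NumberField K],
    Summit.BirchSwinnertonDyer.Rank1Residual.Additive.ClassO6 W 3 → W.HasSurjectiveModNGaloisRep 3 →
    W.analyticRank = 1 → W.conductorNorm ℤ = N →
    IsImaginaryQuadratic K → SatisfiesHeegnerHypothesis N K →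
    ∀ (κ : ZpExtension K 3), κ.IsAnticyclotomic →
    ∀ (𝔭' : HeightOneSpectrum (𝓞 K)), ((3 : ℕ) : 𝓞 K) ∈ 𝔭'.asIdeal →
      Set.Finite {s : AcSelmer.selmerAc (W.baseChange K) 3 κ 𝔭' ∅ | (3 : ℕ) • s = 0}

/-! ## §0b Row predicates: stratum R (g14) and the niveau-2 stratum (NEW, tree vocabulary) -/

/-- **Stratum R — good-ORDINARY mod-3 type at 3** (verbatim g14 `SerreSourceTransport.HasGoodOrdinaryModThreeType`).
[cite: SerreInventiones1972, §1.11 Prop. 11] -/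
def HasGoodOrdinaryModThreeType (W : WeierstrassCurve ℚ) : Prop :=
  ∀ (v : HeightOneSpectrum (𝓞 ℚ)), ((3 : ℕ) : 𝓞 ℚ) ∈ v.asIdeal →
    ∃ (W'' : WeierstrassCurve ℚ) (_ : W''.IsElliptic) (_ : W''.IsGloballyMinimal),
      GoodOrd W'' 3 ∧ ModPCongruentAt W'' W 3 v

/-- **Niveau-2 stratum — `E[3]|D₃` has NO stable line** (census bucket C «irreducible at 3»), spelled exactly as the
hypothesis of the tree theorem `O6.ModPCongruentAt.not_goodOrd_of_forall_not_decompStable`: no subgroup of order 3 of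
`E[3](ℚ̄)` is stable under the decomposition group at the place above 3.  On these rows every weight-2 lift of `ρ̄` is
non-ordinary, the Serre weights of `ρ̄|G_{ℚ₃}` are `Sym⁰ ⊗ detˢ` (`s ∈ {0,1}`), both of which occur in
`JH(σ̄(η ⊕ 1)) = {1, 1, det, Sym², Sym², Sym² ⊗ det}`, and a wild-PS lift `g` has `v₃(a₃(g)) = ½` (forced).
[cite: SerreInventiones1972, §1.11 Prop. 11] -/
def LocallyIrreducibleModThreeType (W : WeierstrassCurve ℚ) : Prop :=
  ∀ (v : HeightOneSpectrum (𝓞 ℚ)), ((3 : ℕ) : 𝓞 ℚ) ∈ v.asIdeal →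
    ∀ Λ : AddSubgroup (geomPoints W), Λ ≤ W.geomTorsion (3 : ℤ) → Nat.card Λ = 3 →
      ∃ σ ∈ GreenbergSelmer.decomp (K := ℚ) v, ∃ x ∈ Λ, σ • x ∉ Λ

/-! ## §1 The three row pieces of the μ-half (same binders as `ResidualSelmerFiniteAtThreeSurj`, split by §0b) -/

/-- **Stratum-R μ-piece** (verbatim g14 `SerreSourceResidualFiniteAtThree`; UNDECIDED · print-adjacent GL₂-type port,
the ordinary SERRE SOURCE). [cite: GreenbergVatsal2000, Thm. (1.4), §2 Prop. (2.8)] -/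
def SerreSourceResidualFiniteAtThree : Prop :=
  ∀ (W : WeierstrassCurve ℚ) [W.IsElliptic] [W.IsGloballyMinimal] (N : ℕ) [NeZero N]
    (K : Type) [Field K] [NumberField K],
    Summit.BirchSwinnertonDyer.Rank1Residual.Additive.ClassO6 W 3 → W.HasSurjectiveModNGaloisRep 3 →
    W.analyticRank = 1 → W.conductorNorm ℤ = N →
    IsImaginaryQuadratic K → SatisfiesHeegnerHypothesis N K →
    HasGoodOrdinaryModThreeType W →
    ∀ (κ : ZpExtension K 3), κ.IsAnticyclotomic →
    ∀ (𝔭' : HeightOneSpectrum (𝓞 K)), ((3 : ℕ) : 𝓞 K) ∈ 𝔭'.asIdeal →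
      Set.Finite {s : AcSelmer.selmerAc (W.baseChange K) 3 κ 𝔭' ∅ | (3 : ℕ) • s = 0}

/-- **Niveau-2 μ-piece (NEW · UNDECIDED; leaves: source EXISTS [ATTACKABLE, print: EG22 Thm 8.6.1 + Brauer identity +
Kisin/Gee at p = 3], residual transport type-blind [ATTACKABLE, GV shape], α-coherent integral divisibility for the
slope-½ wild-PS form [IDEA-NEEDED]).**  On the O6 / onto / `r_an = 1` rows whose `E[3]|D₃` has no stable line,
`Sel_{𝔭′}(K_∞, E[3^∞])[3]` is finite.  Proof route: wild-PS lift `g` of `ρ̄` (type `η ⊕ 1`, level `9·N(ρ̄)`, all level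
primes split in `K`, `v₃(a₃(g)) = ½`, `A_g` good supersingular over `ℚ₃(ζ₉)⁺`) ⇒ α-coherent Heegner classes of `A_g` over
`K_m` / over `K·ℚ(ζ₉)⁺·K_m` ⇒ `μ(X_(∅,0)(A_g)_λ) = 0` ⇒ (type-blind residual transport) the set below is finite.
Why it might fail: no integral anticyclotomic divisibility is in print for a weight-2 form with `9 ∣` level
(non-crystalline at 3; crystalline only over the wild cubic `ℚ₃(ζ₉)⁺`, `e = 3 > p − 1`).
[cite: GreenbergVatsal2000, Thm. (1.4), §2 Prop. (2.8)] -/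
def NiveauTwoResidualFiniteAtThree : Prop :=
  ∀ (W : WeierstrassCurve ℚ) [W.IsElliptic] [W.IsGloballyMinimal] (N : ℕ) [NeZero N]
    (K : Type) [Field K] [NumberField K],
    Summit.BirchSwinnertonDyer.Rank1Residual.Additive.ClassO6 W 3 → W.HasSurjectiveModNGaloisRep 3 →
    W.analyticRank = 1 → W.conductorNorm ℤ = N →
    IsImaginaryQuadratic K → SatisfiesHeegnerHypothesis N K →
    LocallyIrreducibleModThreeType W →
    ∀ (κ : ZpExtension K 3), κ.IsAnticyclotomic →
    ∀ (𝔭' : HeightOneSpectrum (𝓞 K)), ((3 : ℕ) : 𝓞 K) ∈ 𝔭'.asIdeal →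
      Set.Finite {s : AcSelmer.selmerAc (W.baseChange K) 3 κ 𝔭' ∅ | (3 : ℕ) • s = 0}

/-- **Reducible non-ordinary rows μ-piece (UNDECIDED; leaf BARRIER-adjacent).**  The rows whose `E[3]|D₃` HAS a stable
line but NO good-ordinary congruent curve (très ramifié `k(ρ̄) = 4`; unramified-sub / cyclotomic-quotient shape).  A
wild-PS lift of type `η ⊕ 1` exists here too (`Sym²`, `Sym² ⊗ det ∈ JH(σ̄(η ⊕ 1))`), with `a₃(g) ≠ 0` (slope `0`, `½`
or `1` according to the shape of `ρ̄|D₃`); no engine in print.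
[folklore] -/
def ReducibleNonOrdinaryRowsResidualFiniteAtThree : Prop :=
  ∀ (W : WeierstrassCurve ℚ) [W.IsElliptic] [W.IsGloballyMinimal] (N : ℕ) [NeZero N]
    (K : Type) [Field K] [NumberField K],
    Summit.BirchSwinnertonDyer.Rank1Residual.Additive.ClassO6 W 3 → W.HasSurjectiveModNGaloisRep 3 →
    W.analyticRank = 1 → W.conductorNorm ℤ = N →
    IsImaginaryQuadratic K → SatisfiesHeegnerHypothesis N K →
    ¬ HasGoodOrdinaryModThreeType W → ¬ LocallyIrreducibleModThreeType W →
    ∀ (κ : ZpExtension K 3), κ.IsAnticyclotomic →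
    ∀ (𝔭' : HeightOneSpectrum (𝓞 K)), ((3 : ℕ) : 𝓞 K) ∈ 𝔭'.asIdeal →
      Set.Finite {s : AcSelmer.selmerAc (W.baseChange K) 3 κ 𝔭' ∅ | (3 : ℕ) • s = 0}

/-! ## §2 Glue (PROVED): niveau 2 lies in g14's complement; the three strata exhaust the rows -/

/-- There is a place of `ℚ` above `3`. [folklore] -/
theorem exists_place_above_three : ∃ v : HeightOneSpectrum (𝓞 ℚ), ((3 : ℕ) : 𝓞 ℚ) ∈ v.asIdeal :=
  ⟨(primesEquiv (R := 𝓞 ℚ)).symm ⟨3, Nat.prime_three⟩,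
    (Literature.NumberTheory.Automorphic.BCDT.natCast_mem_asIdeal_iff_primesEquiv_eq _ Nat.prime_three).mpr
      (by rw [Equiv.apply_symm_apply])⟩

/-- **Niveau 2 ⊂ complement of stratum R (PROVED).**  If `E[3]|D₃` has no stable line, no curve congruent to `E` at the
place above 3 is good ordinary at 3 (Serre: the kernel of reduction of a good ordinary curve is a `D₃`-stable line;
tree theorem `O6.ModPCongruentAt.not_goodOrd_of_forall_not_decompStable`).  So the new source serves rows that g14's
Serre source cannot. [cite: SerreInventiones1972, §1.11 Prop. 11] -/
theorem not_hasGoodOrdinaryModThreeType_of_locallyIrreducible {W : WeierstrassCurve ℚ}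
    (hirr : LocallyIrreducibleModThreeType W) : ¬ HasGoodOrdinaryModThreeType W := by
  intro hord
  obtain ⟨v, hv⟩ := exists_place_above_three
  obtain ⟨W'', hell, hmin, hgood, hc⟩ := hord v hv
  haveI := hell
  haveI := hmin
  exact hc.not_goodOrd_of_forall_not_decompStable hv (hirr v hv) hgood

/-- Excluded middle on the two row predicates: the three row pieces give the μ-half verbatim. [folklore] -/
theorem residualFinite_of_strata :
    SerreSourceResidualFiniteAtThree → NiveauTwoResidualFiniteAtThree →
      ReducibleNonOrdinaryRowsResidualFiniteAtThree → ResidualSelmerFiniteAtThreeSurj := by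
  intro hR hI hC W _ _ N _ K _ _ hO6 hsurj hr1 hN hK hH κ hκ 𝔭' h3'
  by_cases hrow : HasGoodOrdinaryModThreeType W
  · exact hR W N K hO6 hsurj hr1 hN hK hH hrow κ hκ 𝔭' h3'
  · by_cases hirr : LocallyIrreducibleModThreeType W
    · exact hI W N K hO6 hsurj hr1 hN hK hH hirr κ hκ 𝔭' h3'
    · exact hC W N K hO6 hsurj hr1 hN hK hH hrow hirr κ hκ 𝔭' h3'

/-! ## §3 μ-transparency of a `C₃`-descent / 3-power twist as pure algebra (PROVED)

Used in the engine of §1's niveau-2 piece twice: (i) descending `μ = 0` from `K·ℚ(ζ₉)⁺·K_∞` (where `A_g` is good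
supersingular at the prime above `𝔭`) to `K_∞` along `Gal ≅ C₃`; (ii) comparing `X(T ⊗ ψ)` with `X(T)` for a character
`ψ` of 3-power order.  In both, `σ` of order `3ᵏ` acts on the `𝔽₃`-module `Y = X/3X` unipotently
(`(σ − 1)^{3ᵏ} = σ^{3ᵏ} − 1 = 0`), so `Y/(σ−1)Y` finite forces `Y` finite: `μ` is invisible to the descent. -/

/-- A module with an endomorphism `φ`, `φ ^ n = 0`, and finite cokernel `M ⧸ φ(M)` is finite. [folklore] -/
theorem finite_of_finite_quotient_range_of_pow_eq_zero {R : Type*} [CommRing R] (n : ℕ) :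
    ∀ {M : Type*} [AddCommGroup M] [Module R M] (φ : M →ₗ[R] M),
      φ ^ n = 0 → Finite (M ⧸ LinearMap.range φ) → Finite M := by
  induction n with
  | zero =>
    intro M _ _ φ hφ _
    haveI : Subsingleton M := ⟨fun a b ↦ by
      have h := LinearMap.congr_fun hφ (a - b)
      rw [pow_zero, Module.End.one_apply, LinearMap.zero_apply, sub_eq_zero] at h
      exact h⟩
    infer_instance
  | succ n ih =>
    intro M _ _ φ hφ hfin
    haveI := hfin
    -- `N = φ(M)` is `φ`-stable and `ψ = φ|_N` satisfies `ψ ^ n = 0`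
    let N : Submodule R M := LinearMap.range φ
    have hmem : ∀ x : M, φ x ∈ N := fun x ↦ LinearMap.mem_range_self φ x
    have hst : ∀ x ∈ N, φ x ∈ N := fun x _ ↦ hmem x
    let ψ : N →ₗ[R] N := φ.restrict hst
    have hψpow : ∀ (k : ℕ) (y : N), (((ψ ^ k) y : N) : M) = (φ ^ k) (y : M) := by
      intro k
      induction k with
      | zero => intro y; rfl
      | succ k ihk =>
        intro y
        rw [pow_succ, pow_succ, Module.End.mul_apply, Module.End.mul_apply, ihk (ψ y)]
        rfl
    have hψn : ψ ^ n = 0 := by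
      refine LinearMap.ext fun y ↦ Subtype.ext ?_
      obtain ⟨x, hx⟩ := LinearMap.mem_range.mp y.2
      rw [LinearMap.zero_apply, Submodule.coe_zero, hψpow n y, ← hx, ← Module.End.mul_apply, ← pow_succ, hφ,
        LinearMap.zero_apply]
    -- the surjection `M ⧸ φ(M) ↠ N ⧸ ψ(N)` induced by `φ`
    let g : M →ₗ[R] N ⧸ LinearMap.range ψ :=
      (LinearMap.range ψ).mkQ.comp (LinearMap.codRestrict N φ hmem)
    have hg : N ≤ LinearMap.ker g := by
      rintro _ ⟨y, rfl⟩
      rw [LinearMap.mem_ker]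
      change (LinearMap.range ψ).mkQ (LinearMap.codRestrict N φ hmem (φ y)) = 0
      rw [Submodule.mkQ_apply, Submodule.Quotient.mk_eq_zero]
      exact ⟨⟨φ y, hmem y⟩, rfl⟩
    have hsurj : Function.Surjective (N.liftQ g hg) := by
      intro z
      induction z using Submodule.Quotient.induction_on with
      | H y =>
        obtain ⟨x, hx⟩ := LinearMap.mem_range.mp y.2
        refine ⟨Submodule.Quotient.mk x, ?_⟩
        rw [Submodule.liftQ_apply]
        change (LinearMap.range ψ).mkQ (LinearMap.codRestrict N φ hmem x) = _
        rw [Submodule.mkQ_apply]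
        congr 1
        exact Subtype.ext hx
    haveI : Finite (N ⧸ LinearMap.range ψ) := Finite.of_surjective _ hsurj
    haveI : Finite N := ih ψ hψn inferInstance
    -- an extension of a finite module by a finite module is finite
    have hcard : Nat.card M = Nat.card N * Nat.card (M ⧸ N) := Submodule.card_eq_card_quotient_mul_card N
    have h1 : 0 < Nat.card N := Nat.card_pos
    have h2 : 0 < Nat.card (M ⧸ N) := Nat.card_pos
    exact Nat.finite_of_card_ne_zero (by rw [hcard]; exact (Nat.mul_pos h1 h2).ne')

/-- **μ-transparency (PROVED).** An `𝔽₃`-module `Y` with an automorphism `σ`, `σ ^ 3 = 1`, and finite module of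
coinvariants `Y ⧸ (σ − 1)Y` is finite: `(σ − 1)³ = σ³ − 1 = 0` in characteristic 3.  Reading: for a finitely generated
torsion `Λ[C₃]`-module `X` (e.g. a dual Selmer group over a `C₃`-extension of `K_∞`, or the twist comparison for a
character of 3-power order), `μ(X) = 0 ⟺ μ(X_{C₃}) = 0`. [folklore] -/
theorem finite_of_finite_coinvariants_of_pow_three_eq_one {Y : Type*} [AddCommGroup Y] [Module (ZMod 3) Y]
    (σ : Y →ₗ[ZMod 3] Y) (hσ : σ ^ 3 = 1) (hfin : Finite (Y ⧸ LinearMap.range (σ - 1))) : Finite Y := by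
  refine finite_of_finite_quotient_range_of_pow_eq_zero 3 (σ - 1) ?_ hfin
  have key : ((Polynomial.X : Polynomial (ZMod 3)) - 1) ^ 3 = Polynomial.X ^ 3 - 1 := by
    have h3 : (3 : Polynomial (ZMod 3)) = 0 := by
      rw [← map_ofNat Polynomial.C 3, show (3 : ZMod 3) = 0 by decide, map_zero]
    linear_combination (-(Polynomial.X : Polynomial (ZMod 3)) ^ 2 + Polynomial.X) * h3
  have h : (σ - 1) ^ 3 = σ ^ 3 - 1 := by
    have := congrArg (fun q : Polynomial (ZMod 3) ↦ Polynomial.aeval σ q) key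
    simpa only [map_pow, map_sub, Polynomial.aeval_X, map_one] using this
  rw [h, hσ, sub_self]

/-! ## §4 Registered-shape stubs (`sorry` only here) -/

/-- RATWALL (route crux 24207, WEAKER than the wall; LEAD line `thin_comb`). -/
theorem stub_ratwall : RationalSplitIMCInclusionAtThree := by
  sorry

/-- The SERRE SOURCE on stratum R (UNDECIDED · print-adjacent GL₂-type port; g14's piece). -/
theorem stub_serreSourceRows : SerreSourceResidualFiniteAtThree := by
  sorry

/-- The WILD-PS SOURCE on the niveau-2 rows (UNDECIDED · NEW; leaves ATTACKABLE / IDEA-NEEDED). -/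
theorem stub_niveauTwoRows : NiveauTwoResidualFiniteAtThree := by
  sorry

/-- The reducible non-ordinary rows (UNDECIDED · BARRIER-adjacent). -/
theorem stub_reducibleNonOrdinaryRows : ReducibleNonOrdinaryRowsResidualFiniteAtThree := by
  sorry

/-! ## §5 TOP composition: the crux BY NAME -/

/-- **The wall from RATWALL + the three strata of the μ-half** (g10/g14 kernel road, proof verbatim after assembling the
μ-half from the strata).  `Sel_{𝔭′}(K_∞,E[3^∞])[3]` finite makes `X = X_(∅,0)` `Λ`-torsion with `Ch·R₀⟦T⟧ = (g)`, `g`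
having a unit coefficient (LANDED criterion, GV 2.8 shape); then `3 ∤ g` in the domain `R₀⟦T⟧` where `3` is prime, so
`g ∣ 3^k·L` (RATWALL) forces `g ∣ L`, i.e. `(L) ⊆ (g)`.  Concludes `AdditiveSplitIMCInclusionAtThree` BY NAME; its four
hypotheses are exactly the four registered-shape stubs of §4.
[cite: GreenbergVatsal2000, §2 Prop. (2.8)] [cite: Washington1997, §7.1, §13.2] -/
theorem AdditiveSplitIMCInclusionAtThree_of :
    RationalSplitIMCInclusionAtThree → SerreSourceResidualFiniteAtThree → NiveauTwoResidualFiniteAtThree →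
      ReducibleNonOrdinaryRowsResidualFiniteAtThree → AdditiveSplitIMCInclusionAtThree := by
  intro hR hSR hN2 hC
  have hF : ResidualSelmerFiniteAtThreeSurj := residualFinite_of_strata hSR hN2 hC
  intro W _ _ N _ K _ _ Dt hO6 hsurj hr1 hN hK hH κ hκ γ _ 𝔭 h3 he hf 𝔭' h3' hne ι' hι ΩK Ωp L hΩK hΩp hL
  obtain ⟨k, hk⟩ := hR W N K Dt hO6 hsurj hr1 hN hK hH κ hκ γ 𝔭 h3 he hf 𝔭' h3' hne ι' hι ΩK Ωp L hΩK hΩp hL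
  have hfin := hF W N K hO6 hsurj hr1 hN hK hH κ hκ 𝔭' h3'
  obtain ⟨-, g, hg, i, hi⟩ :=
    Summit.BirchSwinnertonDyer.BirchSwinnertonDyer.Theorems.UniversalToricDescentAcDualMuZero.isTorsion_and_exists_generator_of_finite_pTorsion
      (W.baseChange K) 3 κ 𝔭' ∅ γ Set.finite_empty hfin
  rw [hg] at hk ⊢
  have hdvd : g ∣ ((3 : ℕ) : UnrSeries 3) ^ k * L := Ideal.mem_span_singleton.mp hk
  rw [← map_natCast (PowerSeries.C (R := unrIntegers 3))] at hdvd
  exact Ideal.span_singleton_le_span_singleton.mpr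
    (dvd_of_dvd_prime_pow_mul prime_C_three (not_C_three_dvd_of_norm_coeff_eq_one hi) k hdvd)

/-- The top composition run on the registered-shape stubs: the crux BY NAME (sorries only through `stub_*`). -/
theorem AdditiveSplitIMCInclusionAtThree_holds_of_stubs : AdditiveSplitIMCInclusionAtThree :=
  AdditiveSplitIMCInclusionAtThree_of stub_ratwall stub_serreSourceRows stub_niveauTwoRows stub_reducibleNonOrdinaryRows

/-! ## §6 Bookkeeping (PROVED): the strata are an honest split of the μ-half, and the g10/g14 road is recovered -/

/-- Each stratum piece is implied by the full μ-half (drop the row hypothesis). [folklore] -/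
theorem serreSourceRows_of_residualFinite (hF : ResidualSelmerFiniteAtThreeSurj) :
    SerreSourceResidualFiniteAtThree :=
  fun W _ _ N _ K _ _ hO6 hsurj hr1 hN hK hH _ κ hκ 𝔭' h3' ↦ hF W N K hO6 hsurj hr1 hN hK hH κ hκ 𝔭' h3'

/-- [folklore] -/
theorem niveauTwoRows_of_residualFinite (hF : ResidualSelmerFiniteAtThreeSurj) :
    NiveauTwoResidualFiniteAtThree :=
  fun W _ _ N _ K _ _ hO6 hsurj hr1 hN hK hH _ κ hκ 𝔭' h3' ↦ hF W N K hO6 hsurj hr1 hN hK hH κ hκ 𝔭' h3'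

/-- [folklore] -/
theorem reducibleNonOrdinaryRows_of_residualFinite (hF : ResidualSelmerFiniteAtThreeSurj) :
    ReducibleNonOrdinaryRowsResidualFiniteAtThree :=
  fun W _ _ N _ K _ _ hO6 hsurj hr1 hN hK hH _ _ κ hκ 𝔭' h3' ↦ hF W N K hO6 hsurj hr1 hN hK hH κ hκ 𝔭' h3'

/-- **Honest split (PROVED):** the μ-half is EQUIVALENT to the conjunction of its three strata. [folklore] -/
theorem residualFinite_iff_strata :
    ResidualSelmerFiniteAtThreeSurj ↔
      (SerreSourceResidualFiniteAtThree ∧ NiveauTwoResidualFiniteAtThree ∧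
        ReducibleNonOrdinaryRowsResidualFiniteAtThree) :=
  ⟨fun hF ↦ ⟨serreSourceRows_of_residualFinite hF, niveauTwoRows_of_residualFinite hF,
      reducibleNonOrdinaryRows_of_residualFinite hF⟩,
    fun h ↦ residualFinite_of_strata h.1 h.2.1 h.2.2⟩

/-- **The μ-half road recovered** (g10/g14 `wall_of_ratwall_of_residualFinite`): RATWALL ∧ μ-half ⇒ WALL.
[cite: GreenbergVatsal2000, §2 Prop. (2.8)] -/
theorem wall_of_ratwall_of_residualFinite :
    RationalSplitIMCInclusionAtThree → ResidualSelmerFiniteAtThreeSurj → AdditiveSplitIMCInclusionAtThree :=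
  fun hR hF ↦ AdditiveSplitIMCInclusionAtThree_of hR (serreSourceRows_of_residualFinite hF)
    (niveauTwoRows_of_residualFinite hF) (reducibleNonOrdinaryRows_of_residualFinite hF)

end Summit.BirchSwinnertonDyer.BirchSwinnertonDyer.Cruxes.AdditiveSplitIMCInclusionAtThree.WildPSRetyping

end
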